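import Summits.AtomisticToContinuum.Crystallization.Theorems.PricedLinkCensusSoftFourRingsRigPairsSound
import Summits.AtomisticToContinuum.Crystallization.Theorems.FrustratedLawDichotomySphericalPairBound
import Summits.AtomisticToContinuum.Crystallization.Theorems.HullExactificationCascadeZeroDefectDensityCapAtomsPattern
import HarnessLib

/-!
# FrustratedLawDichotomy · `P` = `CapForcing (1/100)` BY CERTIFIED NUMERICS: the check form
# `SphericalPairBound (1/100) c ρ Pat ⟸ pairChecks` (decomp-a2c, lens 3, gen 32)

The route of record for the residual `P` half of the `FrustratedLawDichotomy` cut is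
`…SphericalPairBound.capForcing_hundredth_of_sphericalBounds`: four scalar bounds on twelve unit
vectors indexed by a kissing pattern (`√3`-pairs `⟪e a, e b⟫ ≤ −257/625`, square diagonals `≤ 7/25`,
fcc / hcp).  This file turns each of them into ONE Boolean hypothesis on certificate DATA for the
pair-target replay of the `Rig` engine (`…RigPairs`, `…RigPairsSound`), everything else proved here:

* §1 the dictionary `↥Pat ↔ Fin 12` (`Rig.patPt`): membership, surjectivity, injectivity, and
  `dist = 1 / √2 / √3` as integer arithmetic on the tables (`sqNormInt (tab i − tab j) = N, 2N, 3N`);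
* §2 the decidable side conditions — `autsOK` (listed relabellings are injective bond automorphisms),
  `coverOK` (every labelled pair at table distance `D` is the image of a listed representative under a
  listed automorphism), `pairChecks` (one passing `checkAllT m [(a, b, C)]` per representative) — and
  the generic ★ `sphericalPairBound_of_pairChecks`;
* §3 the tables: the `48` automorphisms of the cuboctahedron and the `12` of the anticuboctahedron as
  permutations of `Fin 12` (`decide`d), orbit representatives (`fcc √3: (0,6)`; `fcc √2: (0,1)`;
  `hcp √3: (0,3), (0,8)` — two orbits; `hcp √2: (0,6)`), the scaled levels `CSqrt3 = ⌊−257·S²/625⌋`,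
  `CSqrt2 = ⌊7·S²/25⌋` (`S = 2^60`), and the four literals + ★ `capForcing_hundredth_of_pairChecks`.

What remains for `CapForcing (1/100)` is DATA: cell lists `d` with `pairChecks … d = true`, `5`
representative runs in all — supplied by `…SphericalPairCells` (the deviation-run cells of `…RigData`
RETARGETED: terminal `objective` ↦ a Farkas `prune` against the rows `++` the target row; no new
tables), replayed by `native_decide` in `…SphericalPairCheck{FccSqrt3, FccSqrt2, HcpSqrt3a, HcpSqrt3b,
HcpSqrt2}` (as `…RigCheckFcc`), and assembled in `…CapForcingHundredth.capForcing_hundredth`.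
`[folklore]`; no `sorry`; no `instance`/`notation`.
-/

namespace Summit.AtomisticToContinuum.Crystallization.Theorems.FrustratedLawDichotomySphericalPairCheck

open Real RealInnerProductSpace
open Literature.Geometry.DiscreteGeometry
open Summit.AtomisticToContinuum.Crystallization.Theorems.FrustratedLawDichotomyTwoShellRigidityCut (E3 CapForcing)
open Summit.AtomisticToContinuum.Crystallization.Theorems.FrustratedLawDichotomySphericalPairBound
  (SphericalPairBound capForcing_hundredth_of_sphericalBounds)
open Summit.AtomisticToContinuum.Crystallization.Theorems.Rig
  (Model Cell PairTarget checkAllT fccModel hcpModel patPt chiR cbloR cnbR SC fccModel_WF hcpModel_WF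
    inner_lt_of_checkAllT_relabel)

/-! ### §1 The dictionary `↥Pat ↔ Fin 12` -/

/-- Squared distances of model points are integer arithmetic on the table. -/
theorem dist_patPt_sq_mul (m : Model) (hN : m.normSq ≠ 0) (i j : Fin 12) :
    dist (patPt m i) (patPt m j) ^ 2 * m.normSq = (sqNormInt (m.tab i - m.tab j) : ℝ) := by
  -- as `ZeroDefectDensityBirth.dist_smul_intVec_sq_mul` (…ZeroDefectDensityPinsPattern)
  have h0 : (0 : ℝ) ≤ sqNormInt (m.tab i - m.tab j) := by
    have : (0 : ℤ) ≤ sqNormInt (m.tab i - m.tab j) := by unfold sqNormInt; positivity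
    exact_mod_cast this
  have hNpos : (0 : ℝ) < m.normSq := by exact_mod_cast Nat.pos_of_ne_zero hN
  unfold Rig.patPt
  rw [dist_eq_norm, ← smul_sub, intVec_sub, norm_smul, norm_inv,
    Real.norm_of_nonneg (Real.sqrt_nonneg _), norm_intVec, mul_pow, inv_pow,
    Real.sq_sqrt hNpos.le, Real.sq_sqrt h0]
  field_simp

/-- `dist = 1 ↔ |tab i − tab j|² = N`. -/
theorem dist_patPt_eq_one_iff (m : Model) (hN : m.normSq ≠ 0) (i j : Fin 12) :
    dist (patPt m i) (patPt m j) = 1 ↔ sqNormInt (m.tab i - m.tab j) = m.normSq := by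
  unfold Rig.patPt
  exact ZeroDefectDensityBirth.dist_smul_intVec_eq_one_iff hN (m.tab i) (m.tab j)

/-- `dist = √r → |tab i − tab j|² = r·N` (`r ≥ 0`). -/
theorem sqNormInt_of_dist_patPt_eq_sqrt (m : Model) (hN : m.normSq ≠ 0) {r : ℝ} (hr : 0 ≤ r)
    {i j : Fin 12} (h : dist (patPt m i) (patPt m j) = Real.sqrt r) :
    (sqNormInt (m.tab i - m.tab j) : ℝ) = r * m.normSq := by
  rw [← dist_patPt_sq_mul m hN i j, h, Real.sq_sqrt hr]

/-- Model points lie in the scaled pattern of the table. -/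
theorem patPt_mem (m : Model) (i : Fin 12) :
    patPt m i ∈ scaledPattern (Finset.univ.image m.tab) m.normSq := by
  rw [scaledPattern, Finset.image_image]
  exact Finset.mem_image.2 ⟨i, Finset.mem_univ _, rfl⟩

/-- Every point of the scaled pattern of the table is a model point. -/
theorem exists_patPt_of_mem (m : Model) {q : E3}
    (hq : q ∈ scaledPattern (Finset.univ.image m.tab) m.normSq) : ∃ i, patPt m i = q := by
  rw [scaledPattern, Finset.image_image, Finset.mem_image] at hq
  obtain ⟨i, -, hi⟩ := hq
  exact ⟨i, hi⟩

/-- Model points are pairwise distinct for an injective table. -/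
theorem patPt_injective (m : Model) (hN : m.normSq ≠ 0) (htab : Function.Injective m.tab) :
    Function.Injective (patPt m) := fun i j h =>
  htab (scaledPattern_map_injective hN (by simpa [Rig.patPt] using h))

/-! ### §2 Decidable side conditions and the generic wrapper -/

/-- `σ` is an injective relabelling preserving the bond relation (Boolean form). -/
def autOK (bond : Fin 12 → Fin 12 → Bool) (σ : Fin 12 → Fin 12) : Bool :=
  ((List.finRange 12).all fun i => (List.finRange 12).all fun j => !(σ i == σ j) || (i == j)) &&
  ((List.finRange 12).all fun i => (List.finRange 12).all fun j => bond (σ i) (σ j) == bond i j)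

/-- All listed relabellings are bond automorphisms. -/
def autsOK (bond : Fin 12 → Fin 12 → Bool) (auts : List (Fin 12 → Fin 12)) : Bool :=
  auts.all (autOK bond)

/-- Every labelled pair at table distance `D` is a listed automorphic image of a representative. -/
def coverOK (tab : Fin 12 → Fin 3 → ℤ) (D : ℤ) (reps : List (Fin 12 × Fin 12))
    (auts : List (Fin 12 → Fin 12)) : Bool :=
  (List.finRange 12).all fun i => (List.finRange 12).all fun j =>
    !decide (sqNormInt (tab i - tab j) = D) ||
      reps.any fun ab => auts.any fun σ =>
        (σ ab.1 == i && σ ab.2 == j) || (σ ab.1 == j && σ ab.2 == i)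

/-- One passing pair-target check per representative (cell lists aligned with `reps`). -/
def pairChecks (m : Model) (C : ℤ) : List (Fin 12 × Fin 12) → List (List Cell) → Bool
  | [], _ => true
  | _ :: _, [] => false
  | ab :: rs, cells :: ds => checkAllT m [⟨ab.1, ab.2, C⟩] cells && pairChecks m C rs ds
/-- soundness of the automorphism check `autOK`: a checked `σ` preserves the bond relation. [lens-3 g32] -/
theorem autOK_sound {bond : Fin 12 → Fin 12 → Bool} {σ : Fin 12 → Fin 12} (h : autOK bond σ = true) :
    Function.Injective σ ∧ ∀ i j, bond (σ i) (σ j) = bond i j := by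
  unfold autOK at h
  simp only [Bool.and_eq_true, List.all_eq_true, List.mem_finRange, true_implies, Bool.or_eq_true,
    Bool.not_eq_true', beq_eq_false_iff_ne, ne_eq, beq_iff_eq] at h
  obtain ⟨hinj, hb⟩ := h
  refine ⟨fun i j hij => ?_, hb⟩
  rcases hinj i j with h | h
  · exact absurd hij h
  · exact h
/-- soundness of `autsOK`: every listed map is a bond automorphism. [lens-3 g32] -/
theorem autsOK_sound {bond : Fin 12 → Fin 12 → Bool} {auts : List (Fin 12 → Fin 12)}
    (h : autsOK bond auts = true) {σ : Fin 12 → Fin 12} (hσ : σ ∈ auts) :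
    Function.Injective σ ∧ ∀ i j, bond (σ i) (σ j) = bond i j := by
  unfold autsOK at h
  rw [List.all_eq_true] at h
  exact autOK_sound (h σ hσ)
/-- soundness of the orbit-cover check `coverOK`: every pair at the given squared distance is an image of a listed representative under a listed automorphism. [lens-3 g32] -/
theorem coverOK_sound {tab : Fin 12 → Fin 3 → ℤ} {D : ℤ} {reps : List (Fin 12 × Fin 12)}
    {auts : List (Fin 12 → Fin 12)} (h : coverOK tab D reps auts = true) {i j : Fin 12}
    (hD : sqNormInt (tab i - tab j) = D) :
    ∃ ab ∈ reps, ∃ σ ∈ auts, (σ ab.1 = i ∧ σ ab.2 = j) ∨ (σ ab.1 = j ∧ σ ab.2 = i) := by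
  unfold coverOK at h
  simp only [List.all_eq_true, List.mem_finRange, true_implies, Bool.or_eq_true, Bool.not_eq_true',
    decide_eq_false_iff_not, List.any_eq_true, Bool.and_eq_true, beq_iff_eq] at h
  rcases h i j with h | h
  · exact absurd hD h
  · exact h
/-- soundness of the per-representative pair checks: each listed representative pair satisfies the certified inner-product bound. [lens-3 g32] -/
theorem pairChecks_sound {m : Model} {C : ℤ} : ∀ {reps : List (Fin 12 × Fin 12)}
    {data : List (List Cell)}, pairChecks m C reps data = true →
    ∀ ab ∈ reps, ∃ cells, checkAllT m [⟨ab.1, ab.2, C⟩] cells = true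
  | [], _, _ => by simp
  | _ :: _, [], h => by simp [pairChecks] at h
  | ab :: rs, cells :: ds, h => by
    simp only [pairChecks, Bool.and_eq_true] at h
    intro ab' hab'
    rcases List.mem_cons.1 hab' with rfl | hmem
    · exact ⟨cells, h.1⟩
    · exact pairChecks_sound h.2 ab' hmem

/-- The three one-percent levels of `SphericalPairBound (1/100)` are the engine's `chiR, cbloR, cnbR`. -/
theorem chi_hundredth : (1 : ℝ) - (1 + 1 / 100)⁻¹ ^ 2 / 2 = chiR := by rw [Rig.chiR]; norm_num
/-- the bonded lower cosine window constant at `θ = 1/100`. [lens-3 g32] -/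
theorem cblo_hundredth : (1 : ℝ) - (1 + 1 / 100) ^ 2 / 2 = cbloR := by rw [Rig.cbloR]; norm_num
/-- the non-bonded upper cosine window constant at `θ = 1/100`. [lens-3 g32] -/
theorem cnb_hundredth : ((1 : ℝ) + 1 / 100) / 2 = cnbR := by rw [Rig.cnbR]; norm_num

/-- ★ **`SphericalPairBound (1/100) c ρ Pat` from certified pair checks.**  For a well-formed model whose
table enumerates `Pat` (bonds = unit distances), a level `C ≤ c·S²`, a table distance `D` detecting
`dist = ρ`, bond automorphisms `auts` covering every pair at table distance `D` from the representatives
`reps`, and one passing pair-target check per representative: every pattern pair at distance `ρ` has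
`⟪e a, e b⟫ ≤ c`. -/
theorem sphericalPairBound_of_pairChecks {m : Model} (hW : m.WF) (hN : m.normSq ≠ 0)
    (htab : Function.Injective m.tab)
    (hbondAdj : ∀ i j, m.bond i j = true ↔ sqNormInt (m.tab i - m.tab j) = m.normSq)
    {Pat : Finset E3} (hPat : Pat = scaledPattern (Finset.univ.image m.tab) m.normSq)
    {c ρ : ℝ} {D C : ℤ}
    (hD : ∀ i j, dist (patPt m i) (patPt m j) = ρ → sqNormInt (m.tab i - m.tab j) = D)
    (hC : (C : ℝ) ≤ (SC : ℝ) * SC * c)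
    {reps : List (Fin 12 × Fin 12)} {auts : List (Fin 12 → Fin 12)} {data : List (List Cell)}
    (hauts : autsOK m.bond auts = true) (hcov : coverOK m.tab D reps auts = true)
    (hchk : pairChecks m C reps data = true) :
    SphericalPairBound (1 / 100) c ρ Pat := by
  intro e he1 he2 he3 he4 a b hab
  have hS : (0 : ℝ) < SC := by exact_mod_cast Rig.SC_pos
  have hS2 : (0 : ℝ) < (SC : ℝ) * SC := mul_pos hS hS
  -- the dictionary
  have hmem : ∀ i, patPt m i ∈ Pat := fun i => hPat ▸ patPt_mem m i
  let g : Fin 12 → ↥Pat := fun i => ⟨patPt m i, hmem i⟩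
  have hg : ∀ i, ((g i : ↥Pat) : E3) = patPt m i := fun i => rfl
  have hginj : Function.Injective g := fun i j h =>
    patPt_injective m hN htab (by simpa [g] using congrArg Subtype.val h)
  have hsub : ∀ q, q ∈ Pat → q ∈ scaledPattern (Finset.univ.image m.tab) m.normSq :=
    fun q hq => by rw [← hPat]; exact hq
  obtain ⟨i, hi⟩ := exists_patPt_of_mem m (hsub _ a.2)
  obtain ⟨j, hj⟩ := exists_patPt_of_mem m (hsub _ b.2)
  have hai : a = g i := Subtype.ext hi.symm
  have hbj : b = g j := Subtype.ext hj.symm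
  subst hai hbj
  -- the twelve labelled unit vectors and their windows
  set p : Fin 12 → E3 := fun k => e (g k) with hp
  have hp1 : ∀ k, ‖p k‖ = 1 := fun k => he1 (g k)
  have hall : ∀ k l, k ≠ l → ⟪p k, p l⟫ ≤ chiR := fun k l hkl =>
    chi_hundredth ▸ he2 (g k) (g l) (hginj.ne hkl)
  have hbond : ∀ k l, k ≠ l → m.bond k l = true → cbloR ≤ ⟪p k, p l⟫ := by
    intro k l _ hb
    have h1 : dist ((g k : ↥Pat) : E3) (g l) = 1 := (dist_patPt_eq_one_iff m hN k l).2 ((hbondAdj k l).1 hb)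
    exact cblo_hundredth ▸ he3 (g k) (g l) h1
  have hnb : ∀ k l, k ≠ l → m.bond k l = false → ⟪p k, p l⟫ ≤ cnbR := by
    intro k l hkl hb
    have h1 : dist ((g k : ↥Pat) : E3) (g l) ≠ 1 := by
      intro h1
      have := (hbondAdj k l).2 ((dist_patPt_eq_one_iff m hN k l).1 h1)
      rw [hb] at this; exact Bool.false_ne_true this
    have := he4 (g k) (g l) (hginj.ne hkl) h1
    rw [cnb_hundredth] at this; exact this.le
  -- the representative and the automorphism
  have hDij : sqNormInt (m.tab i - m.tab j) = D := hD i j hab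
  obtain ⟨ab, hab', σ, hσ, hcases⟩ := coverOK_sound hcov hDij
  obtain ⟨hσinj, hσb⟩ := autsOK_sound hauts hσ
  obtain ⟨cells, hcells⟩ := pairChecks_sound hchk ab hab'
  have hlt := inner_lt_of_checkAllT_relabel hW hcells hσinj hσb p hp1 hall hbond hnb
  have hle : (C : ℝ) / ((SC : ℝ) * SC) ≤ c := by rw [div_le_iff₀ hS2]; linarith
  rcases hcases with ⟨h1, h2⟩ | ⟨h1, h2⟩
  · rw [h1, h2] at hlt; exact (hlt.trans_le hle).le
  · rw [h1, h2, real_inner_comm] at hlt; exact (hlt.trans_le hle).le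

/-! ### §3 Tables, levels, literals -/

/-- The `48` automorphisms of the cuboctahedron (signed coordinate permutations) on the labels of `fccTab`. -/
def fccAuts : List (Fin 12 → Fin 12) :=
  [![0, 1, 2, 3, 4, 5, 6, 7, 8, 9, 10, 11],
   ![0, 1, 2, 3, 5, 4, 7, 6, 9, 8, 11, 10],
   ![0, 2, 1, 3, 8, 9, 10, 11, 4, 5, 6, 7],
   ![0, 2, 1, 3, 9, 8, 11, 10, 5, 4, 7, 6],
   ![1, 0, 3, 2, 4, 5, 6, 7, 10, 11, 8, 9],
   ![1, 0, 3, 2, 5, 4, 7, 6, 11, 10, 9, 8],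
   ![1, 3, 0, 2, 10, 11, 8, 9, 4, 5, 6, 7],
   ![1, 3, 0, 2, 11, 10, 9, 8, 5, 4, 7, 6],
   ![2, 0, 3, 1, 8, 9, 10, 11, 6, 7, 4, 5],
   ![2, 0, 3, 1, 9, 8, 11, 10, 7, 6, 5, 4],
   ![2, 3, 0, 1, 6, 7, 4, 5, 8, 9, 10, 11],
   ![2, 3, 0, 1, 7, 6, 5, 4, 9, 8, 11, 10],
   ![3, 1, 2, 0, 10, 11, 8, 9, 6, 7, 4, 5],
   ![3, 1, 2, 0, 11, 10, 9, 8, 7, 6, 5, 4],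
   ![3, 2, 1, 0, 6, 7, 4, 5, 10, 11, 8, 9],
   ![3, 2, 1, 0, 7, 6, 5, 4, 11, 10, 9, 8],
   ![4, 5, 6, 7, 0, 1, 2, 3, 8, 10, 9, 11],
   ![4, 5, 6, 7, 1, 0, 3, 2, 10, 8, 11, 9],
   ![4, 6, 5, 7, 8, 10, 9, 11, 0, 1, 2, 3],
   ![4, 6, 5, 7, 10, 8, 11, 9, 1, 0, 3, 2],
   ![5, 4, 7, 6, 0, 1, 2, 3, 9, 11, 8, 10],
   ![5, 4, 7, 6, 1, 0, 3, 2, 11, 9, 10, 8],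
   ![5, 7, 4, 6, 9, 11, 8, 10, 0, 1, 2, 3],
   ![5, 7, 4, 6, 11, 9, 10, 8, 1, 0, 3, 2],
   ![6, 4, 7, 5, 8, 10, 9, 11, 2, 3, 0, 1],
   ![6, 4, 7, 5, 10, 8, 11, 9, 3, 2, 1, 0],
   ![6, 7, 4, 5, 2, 3, 0, 1, 8, 10, 9, 11],
   ![6, 7, 4, 5, 3, 2, 1, 0, 10, 8, 11, 9],
   ![7, 5, 6, 4, 9, 11, 8, 10, 2, 3, 0, 1],
   ![7, 5, 6, 4, 11, 9, 10, 8, 3, 2, 1, 0],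
   ![7, 6, 5, 4, 2, 3, 0, 1, 9, 11, 8, 10],
   ![7, 6, 5, 4, 3, 2, 1, 0, 11, 9, 10, 8],
   ![8, 9, 10, 11, 0, 2, 1, 3, 4, 6, 5, 7],
   ![8, 9, 10, 11, 2, 0, 3, 1, 6, 4, 7, 5],
   ![8, 10, 9, 11, 4, 6, 5, 7, 0, 2, 1, 3],
   ![8, 10, 9, 11, 6, 4, 7, 5, 2, 0, 3, 1],
   ![9, 8, 11, 10, 0, 2, 1, 3, 5, 7, 4, 6],
   ![9, 8, 11, 10, 2, 0, 3, 1, 7, 5, 6, 4],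
   ![9, 11, 8, 10, 5, 7, 4, 6, 0, 2, 1, 3],
   ![9, 11, 8, 10, 7, 5, 6, 4, 2, 0, 3, 1],
   ![10, 8, 11, 9, 4, 6, 5, 7, 1, 3, 0, 2],
   ![10, 8, 11, 9, 6, 4, 7, 5, 3, 1, 2, 0],
   ![10, 11, 8, 9, 1, 3, 0, 2, 4, 6, 5, 7],
   ![10, 11, 8, 9, 3, 1, 2, 0, 6, 4, 7, 5],
   ![11, 9, 10, 8, 5, 7, 4, 6, 1, 3, 0, 2],
   ![11, 9, 10, 8, 7, 5, 6, 4, 3, 1, 2, 0],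
   ![11, 10, 9, 8, 1, 3, 0, 2, 5, 7, 4, 6],
   ![11, 10, 9, 8, 3, 1, 2, 0, 7, 5, 6, 4]]
/-- The `12` automorphisms of the anticuboctahedron (`D₃ₕ`) on the labels of `hcpTab`. -/
def hcpAuts : List (Fin 12 → Fin 12) :=
  [![0, 1, 2, 3, 4, 5, 6, 7, 8, 9, 10, 11],
   ![0, 1, 2, 3, 4, 5, 9, 10, 11, 6, 7, 8],
   ![1, 0, 4, 5, 2, 3, 6, 8, 7, 9, 11, 10],
   ![1, 0, 4, 5, 2, 3, 9, 11, 10, 6, 8, 7],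
   ![2, 3, 0, 1, 5, 4, 7, 6, 8, 10, 9, 11],
   ![2, 3, 0, 1, 5, 4, 10, 9, 11, 7, 6, 8],
   ![3, 2, 5, 4, 0, 1, 7, 8, 6, 10, 11, 9],
   ![3, 2, 5, 4, 0, 1, 10, 11, 9, 7, 8, 6],
   ![4, 5, 1, 0, 3, 2, 8, 6, 7, 11, 9, 10],
   ![4, 5, 1, 0, 3, 2, 11, 9, 10, 8, 6, 7],
   ![5, 4, 3, 2, 1, 0, 8, 7, 6, 11, 10, 9],
   ![5, 4, 3, 2, 1, 0, 11, 10, 9, 8, 7, 6]]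
/-- the listed fcc maps are bond automorphisms (by `decide`). [lens-3 g32] -/
theorem fccAuts_ok : autsOK fccModel.bond fccAuts = true := by decide
/-- the listed hcp maps are bond automorphisms (by `decide`). [lens-3 g32] -/
theorem hcpAuts_ok : autsOK hcpModel.bond hcpAuts = true := by decide

/-- Orbit representatives of the labelled pairs at squared distance `3` / `2` (table distance `3N` / `2N`). -/
def fccRepsSqrt3 : List (Fin 12 × Fin 12) := [(0, 6)]

/-- see `fccRepsSqrt3` -/
def fccRepsSqrt2 : List (Fin 12 × Fin 12) := [(0, 1)]

/-- see `fccRepsSqrt3` (two orbits: in-layer pairs and layer–triangle pairs) -/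
def hcpRepsSqrt3 : List (Fin 12 × Fin 12) := [(0, 3), (0, 8)]

/-- see `fccRepsSqrt3` -/
def hcpRepsSqrt2 : List (Fin 12 × Fin 12) := [(0, 6)]
/-- the fcc representatives at squared distance `6` (`√3` pairs) cover their orbit (by `decide`). [lens-3 g32] -/
theorem fcc_cover_sqrt3 : coverOK fccTab 6 fccRepsSqrt3 fccAuts = true := by decide
/-- the fcc representatives at squared distance `4` (`√2` pairs) cover their orbit (by `decide`). [lens-3 g32] -/
theorem fcc_cover_sqrt2 : coverOK fccTab 4 fccRepsSqrt2 fccAuts = true := by decide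
/-- the hcp representatives at squared distance `54` (`√3` pairs, hcp table scale) cover their orbit (by `decide`). [lens-3 g32] -/
theorem hcp_cover_sqrt3 : coverOK hcpTab 54 hcpRepsSqrt3 hcpAuts = true := by decide
/-- the hcp representatives at squared distance `36` (`√2` pairs, hcp table scale) cover their orbit (by `decide`). [lens-3 g32] -/
theorem hcp_cover_sqrt2 : coverOK hcpTab 36 hcpRepsSqrt2 hcpAuts = true := by decide

/-- The scaled levels `⌊c·S²⌋` of the two literals (`S = 2^60`). -/
def CSqrt3 : ℤ := -546578551866757406938045463187277690

/-- see `CSqrt3` -/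
def CSqrt2 : ℤ := 372183838819776444413065976878496481
/-- the certified `√3` level: `CSqrt3 ≤ SC² · (−257/625)`. [lens-3 g32] -/
theorem CSqrt3_le : (CSqrt3 : ℝ) ≤ (SC : ℝ) * SC * (-257 / 625) := by
  rw [CSqrt3, Rig.SC]; norm_num
/-- the certified `√2` level: `CSqrt2 ≤ SC² · (7/25)`. [lens-3 g32] -/
theorem CSqrt2_le : (CSqrt2 : ℝ) ≤ (SC : ℝ) * SC * (7 / 25) := by
  rw [CSqrt2, Rig.SC]; norm_num
/-- the fcc model bond relation is the unit-contact relation of the tabulated pattern. [lens-3 g32] -/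
theorem fcc_bondAdj : ∀ i j, fccModel.bond i j = true ↔
    sqNormInt (fccModel.tab i - fccModel.tab j) = fccModel.normSq := by decide
/-- the hcp model bond relation is the unit-contact relation of the tabulated pattern. [lens-3 g32] -/
theorem hcp_bondAdj : ∀ i j, hcpModel.bond i j = true ↔
    sqNormInt (hcpModel.tab i - hcpModel.tab j) = hcpModel.normSq := by decide
/-- the tree `fccKissingPattern` is the scaled tabulated fcc pattern. [lens-3 g32] -/
theorem fccPattern_eq : fccKissingPattern = scaledPattern (Finset.univ.image fccModel.tab) fccModel.normSq := by
  rw [fccKissingPattern, fccInt_eq_image]; rfl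
/-- the tree `hcpKissingPattern` is the scaled tabulated hcp pattern. [lens-3 g32] -/
theorem hcpPattern_eq : hcpKissingPattern = scaledPattern (Finset.univ.image hcpModel.tab) hcpModel.normSq := by
  rw [hcpKissingPattern, hcpInt_eq_image]; rfl

/-- Table distance of a pattern pair at distance `√r`: fcc `2r`, hcp `18r`. -/
theorem fcc_tabDist {r : ℝ} (hr : 0 ≤ r) {D : ℤ} (hDr : (D : ℝ) = r * 2) (i j : Fin 12)
    (h : dist (patPt fccModel i) (patPt fccModel j) = Real.sqrt r) :
    sqNormInt (fccModel.tab i - fccModel.tab j) = D := by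
  have := sqNormInt_of_dist_patPt_eq_sqrt fccModel (by decide) hr h
  have h2 : ((fccModel.normSq : ℕ) : ℝ) = 2 := by norm_num [Rig.fccModel]
  rw [h2, ← hDr] at this; exact_mod_cast this

/-- see `fcc_tabDist` -/
theorem hcp_tabDist {r : ℝ} (hr : 0 ≤ r) {D : ℤ} (hDr : (D : ℝ) = r * 18) (i j : Fin 12)
    (h : dist (patPt hcpModel i) (patPt hcpModel j) = Real.sqrt r) :
    sqNormInt (hcpModel.tab i - hcpModel.tab j) = D := by
  have := sqNormInt_of_dist_patPt_eq_sqrt hcpModel (by decide) hr h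
  have h2 : ((hcpModel.normSq : ℕ) : ℝ) = 18 := by norm_num [Rig.hcpModel]
  rw [h2, ← hDr] at this; exact_mod_cast this

/-- **fcc `√3`-pairs** from one representative run. -/
theorem sphericalPairBound_fcc_sqrt3 {d : List (List Cell)}
    (h : pairChecks fccModel CSqrt3 fccRepsSqrt3 d = true) :
    SphericalPairBound (1 / 100) (-257 / 625) (Real.sqrt 3) fccKissingPattern :=
  sphericalPairBound_of_pairChecks fccModel_WF (by decide) fccTab_injective fcc_bondAdj fccPattern_eq
    (fcc_tabDist (by norm_num) (by norm_num)) CSqrt3_le fccAuts_ok fcc_cover_sqrt3 h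

/-- **hcp `√3`-pairs** from two representative runs. -/
theorem sphericalPairBound_hcp_sqrt3 {d : List (List Cell)}
    (h : pairChecks hcpModel CSqrt3 hcpRepsSqrt3 d = true) :
    SphericalPairBound (1 / 100) (-257 / 625) (Real.sqrt 3) hcpKissingPattern :=
  sphericalPairBound_of_pairChecks hcpModel_WF (by decide) hcpTab_injective hcp_bondAdj hcpPattern_eq
    (hcp_tabDist (by norm_num) (by norm_num)) CSqrt3_le hcpAuts_ok hcp_cover_sqrt3 h

/-- **fcc square diagonals** from one representative run. -/
theorem sphericalPairBound_fcc_sqrt2 {d : List (List Cell)}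
    (h : pairChecks fccModel CSqrt2 fccRepsSqrt2 d = true) :
    SphericalPairBound (1 / 100) (7 / 25) (Real.sqrt 2) fccKissingPattern :=
  sphericalPairBound_of_pairChecks fccModel_WF (by decide) fccTab_injective fcc_bondAdj fccPattern_eq
    (fcc_tabDist (by norm_num) (by norm_num)) CSqrt2_le fccAuts_ok fcc_cover_sqrt2 h

/-- **hcp square diagonals** from one representative run. -/
theorem sphericalPairBound_hcp_sqrt2 {d : List (List Cell)}
    (h : pairChecks hcpModel CSqrt2 hcpRepsSqrt2 d = true) :
    SphericalPairBound (1 / 100) (7 / 25) (Real.sqrt 2) hcpKissingPattern :=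
  sphericalPairBound_of_pairChecks hcpModel_WF (by decide) hcpTab_injective hcp_bondAdj hcpPattern_eq
    (hcp_tabDist (by norm_num) (by norm_num)) CSqrt2_le hcpAuts_ok hcp_cover_sqrt2 h

/-- ★ **`CapForcing (1/100)` from the five certified representative runs** (data hypotheses only). -/
theorem capForcing_hundredth_of_pairChecks {d₁ d₂ d₃ d₄ : List (List Cell)}
    (h₁ : pairChecks fccModel CSqrt3 fccRepsSqrt3 d₁ = true)
    (h₂ : pairChecks hcpModel CSqrt3 hcpRepsSqrt3 d₂ = true)
    (h₃ : pairChecks fccModel CSqrt2 fccRepsSqrt2 d₃ = true)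
    (h₄ : pairChecks hcpModel CSqrt2 hcpRepsSqrt2 d₄ = true) : CapForcing (1 / 100) :=
  capForcing_hundredth_of_sphericalBounds (sphericalPairBound_fcc_sqrt3 h₁)
    (sphericalPairBound_hcp_sqrt3 h₂) (sphericalPairBound_fcc_sqrt2 h₃) (sphericalPairBound_hcp_sqrt2 h₄)

end Summit.AtomisticToContinuum.Crystallization.Theorems.FrustratedLawDichotomySphericalPairCheck
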